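/-
Fleet lead `ym-wcr-19609-p1` (seat prover-ym-wcr-19609-p1-g2-0), route `WeakCouplingRates`, crux `BulkDominatesColdBoxW`
(stmt-QuantumFields-19609), line `dlr-chessboard` (v8): the A-cov assembly at FIXED `β` — the deterministic core with datum.
-/
import Summits.QuantumFields.YangMills.Theorems.WeakCouplingRatesBulkDominatesColdBoxWKernelCovCoreMoments
import Summits.QuantumFields.YangMills.Theorems.WeakCouplingRatesColdBoxRepresentationDatum
import Summits.QuantumFields.YangMills.Theorems.WeakCouplingRatesBulkDominatesColdBoxWSmallFieldGoodTD
import Summits.QuantumFields.YangMills.Theorems.WeakCouplingRatesBulkDominatesColdBoxWShiftSmall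
import Summits.QuantumFields.YangMills.Theorems.WeakCouplingRatesBulkDominatesColdBoxWUnitsShift
import Summits.QuantumFields.YangMills.Theorems.WeakCouplingRatesColdBoxColourCov
import Summits.QuantumFields.YangMills.Theorems.WeakCouplingRatesColdBoxDominationCore

/-!
# Crux `BulkDominatesColdBoxW`, stub `stub_kernelCovExpansion`: the one-scale expansion of the kernel COVARIANCE with datum,
# ASSEMBLED at fixed `β` (datum twin of `abs_boxPlaqCov_sub_dirCircSqCov_le_core`)

For a box datum `W` in chart form off the cold box (`W e = gnomonicChart (ϑ · e)`, `Σ_c ϑ_c(e)² ≤ r²` off `Λ`, `ϑ = 0` on the forest) with the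
energy clause `Σ_c M_{ϑ_c}(s_c) ≤ B`, the kernel `γ(·|W) = boxKernel β H W` satisfies, at the centre pair `p = (boxCentre H; 1,2)`,
`q = p + T e₀` (`T ≤ H`):

  `|β²·Cov_{γ(·|W)}(c_p, c_q) − ((3/2)·C_D(p,q)² + 2β(Σ_c F̄_c(p)F̄_c(q))·C_D(p,q))|`
    `≤ 96β²·pY + 3M²(e^{2w}−1) + 6M²·P + 2τ(M + K₁) + √P·(2MK₁ + K₂ + K₁²)`,

`M = β^{2ε}`, `τ = 362βm³`, `w = #(plaquettesTouching Λ)·τ + 2·#(ColdFreeIdx H)·m²`, `K₁ = 6R'² + 11`, `K₂ = 26R'⁴ + 261`, where the real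
bookkeeping parameters satisfy: `γ(·|W)((coldGoodSet)ᶜ) ≤ pY < 1` (YM large fields), `√2(12H²+2H+1)(√(β^{2ε−1}) + 8r) ≤ m ≤ ¼` (T4 link bound),
`√(2βB) + 4√(2β)r ≤ R'` (the scaled background circulation bound, ALL plaquettes: `abs_dirBackground_sdat_le`), and the goodTD sandwich windows
(`smallField_subset_goodTD`) with Gaussian threshold `R` and `720(2H+1)⁴e^{−R²/2} ≤ P < 1`.
Chain: T3 `integral_cond_boxKernel_eq_integral_tilted_datum` (×3), T4 `abs_tiltWD_le_of_mem_goodTD`, R3-datum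
`abs_beta_mul_plaqCostAt_sub_qObsD_le_of_mem_goodTD` + units `qObsD_eq_half_sum_sq`, the sandwich `gauss3_real_compl_goodTD_le`, and the abstract
core `abs_kernelCov_sub_gaussian_le_moments`; then the Gaussian moment constants are bounded through `|F_c| ≤ R'`, `0 ≤ C_D(p,p) ≤ 1`.
No sorry; no new definition; standard axioms.  NOT a claim about the mass gap.
-/

set_option autoImplicit false

noncomputable section

open MeasureTheory ProbabilityTheory Finset Real
open Literature.Probability.LatticeModels (Site)
open Literature.MathematicalPhysics.QuantumLattice
open Literature.MathematicalPhysics.QuantumFieldTheory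
open Literature.MathematicalPhysics.QuantumFieldTheory.LatticeMaxwell
open Literature.MathematicalPhysics.QuantumFieldTheory.AxialGauge

namespace Summit.QuantumFields.YangMills.Theorems.WeakCouplingRates

variable {H : ℕ}

/-! ## The scaled background circulation is bounded on every plaquette -/

/-- Off the cold box the glued scaled datum is `≤ √(2β)·r` in absolute value (pinned collar value `√(2β)ϑ_c(e)`, or `0` off the enlarged box). -/
theorem abs_glue_sdat_le_of_not_mem {β r : ℝ} (hr : 0 ≤ r) {ϑ : Fin 3 → Literature.MathematicalPhysics.QuantumLattice.ZdEdge 4 → ℝ}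
    (hϑ : ∀ e, e ∉ boxEdges 4 (2 * H + 1) → ∑ c, ϑ c e ^ 2 ≤ r ^ 2) (c : Fin 3) (m : DirFree H → ℝ)
    {e : Literature.MathematicalPhysics.QuantumLattice.ZdEdge 4} (he : e ∉ boxEdges 4 (2 * H + 1)) :
    |glue (pin := fun e => e ∉ dirFreeEdges H) dirCorner (2 * H + 3) (sdat β ϑ c) m e| ≤ Real.sqrt (2 * β) * r := by
  by_cases hE : e ∈ boxEdgesAt dirCorner (2 * H + 3)
  · have hpin : e ∉ dirFreeEdges H := fun h => he (mem_dirFreeEdges.1 h).1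
    rw [glue_apply_pin _ _ hE hpin, sdat_apply, abs_mul, abs_of_nonneg (Real.sqrt_nonneg _)]
    exact mul_le_mul_of_nonneg_left (abs_apply_le_of_sum_sq_le hr (hϑ e he) c) (Real.sqrt_nonneg _)
  · rw [glue_apply_of_not_mem _ _ hE, abs_zero]; exact mul_nonneg (Real.sqrt_nonneg _) hr

/-- **The scaled background circulation is uniformly bounded on ALL plaquettes of `ℤ⁴`**: `|F'_c(p)| ≤ √(2βB) + 4√(2β)r`, where
`F'_c = sCirc (glue ϑ'_c (mean ϑ'_c))`, `ϑ' = √(2β)ϑ`, `B` bounds the three-colour energy `Σ_c M_{ϑ_c}(s_c)` and `r` the datum off the cold box.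
On a plaquette touching the box this is the energy bound (`sqrt_two_beta_mul_abs_dirBackground_le`); a plaquette NOT touching the box has all four
edges pinned or outside the enlarged box, so its circulation is a signed sum of at most four collar values `≤ √(2β)r`. -/
theorem abs_dirBackground_sdat_le {β r B : ℝ} (hβ : 0 ≤ β) (hr : 0 ≤ r)
    {ϑ : Fin 3 → Literature.MathematicalPhysics.QuantumLattice.ZdEdge 4 → ℝ} (s : Fin 3 → DirFree H → ℝ)
    (hE : ∑ c, formM (fun e => e ∉ dirFreeEdges H) dirCorner (2 * H + 3) (ϑ c) (s c) ≤ B)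
    (hϑ : ∀ e, e ∉ boxEdges 4 (2 * H + 1) → ∑ c, ϑ c e ^ 2 ≤ r ^ 2) (c : Fin 3) (p : ZdPlaquette 4) :
    |sCirc (glue (pin := fun e => e ∉ dirFreeEdges H) dirCorner (2 * H + 3) (sdat β ϑ c)
        (mean (fun e => e ∉ dirFreeEdges H) dirCorner (2 * H + 3) (sdat β ϑ c))) (p.1, p.2.1.1, p.2.1.2)| ≤
      Real.sqrt (2 * β * B) + 4 * (Real.sqrt (2 * β) * r) := by
  have h4 : 0 ≤ 4 * (Real.sqrt (2 * β) * r) := by positivity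
  have hsq : 0 ≤ Real.sqrt (2 * β * B) := Real.sqrt_nonneg _
  by_cases hp : p ∈ plaquettesTouching (boxEdges 4 (2 * H + 1))
  · rw [dirBackground_sdat_eq, abs_mul, abs_of_nonneg (Real.sqrt_nonneg _)]
    exact (sqrt_two_beta_mul_abs_dirBackground_le H hβ ϑ s hE hp c).trans (le_add_of_nonneg_right h4)
  · have hno : ∀ e ∈ plaquetteEdges p, e ∉ boxEdges 4 (2 * H + 1) := fun e he heΛ =>
      hp (mem_plaquettesTouching_iff.2 ⟨e, Finset.mem_inter.2 ⟨he, heΛ⟩⟩)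
    set A := glue (pin := fun e => e ∉ dirFreeEdges H) dirCorner (2 * H + 3) (sdat β ϑ c)
        (mean (fun e => e ∉ dirFreeEdges H) dirCorner (2 * H + 3) (sdat β ϑ c)) with hA
    have hb : ∀ e ∈ plaquetteEdges p, |A e| ≤ Real.sqrt (2 * β) * r := fun e he =>
      abs_glue_sdat_le_of_not_mem hr hϑ c _ (hno e he)
    have h1 := hb (p.1, p.2.1.1) (by simp [plaquetteEdges])
    have h2 := hb (p.1 + Pi.single p.2.1.1 1, p.2.1.2) (by simp [plaquetteEdges])
    have h3 := hb (p.1 + Pi.single p.2.1.2 1, p.2.1.1) (by simp [plaquetteEdges])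
    have h4' := hb (p.1, p.2.1.2) (by simp [plaquetteEdges])
    have hexp : sCirc A (p.1, p.2.1.1, p.2.1.2) =
        A (p.1, p.2.1.1) + A (p.1 + Pi.single p.2.1.1 1, p.2.1.2) - A (p.1 + Pi.single p.2.1.2 1, p.2.1.1) - A (p.1, p.2.1.2) := rfl
    rw [hexp]
    have := abs_add_le (A (p.1, p.2.1.1)) (A (p.1 + Pi.single p.2.1.1 1, p.2.1.2))
    have := abs_sub (A (p.1, p.2.1.1) + A (p.1 + Pi.single p.2.1.1 1, p.2.1.2)) (A (p.1 + Pi.single p.2.1.2 1, p.2.1.1))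
    have := abs_sub (A (p.1, p.2.1.1) + A (p.1 + Pi.single p.2.1.1 1, p.2.1.2) - A (p.1 + Pi.single p.2.1.2 1, p.2.1.1))
      (A (p.1, p.2.1.2))
    linarith

/-! ## Bounds for the Gaussian moment constants of the core -/

/-- `√(6Σ_c(F_c⁴+3a²) + 6Σ_c(G_c⁴+3b²)) ≤ 6R'² + 11` when `|F_c|, |G_c| ≤ R'` and `a, b ∈ [0,1]`. -/
theorem sqrt_moment_two_le {F G : Fin 3 → ℝ} {R' a b : ℝ} (hF : ∀ c, |F c| ≤ R') (hG : ∀ c, |G c| ≤ R')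
    (ha : 0 ≤ a) (ha1 : a ≤ 1) (hb : 0 ≤ b) (hb1 : b ≤ 1) :
    6 * ∑ c, (F c ^ 4 + 3 * a ^ 2) + 6 * ∑ c, (G c ^ 4 + 3 * b ^ 2) ≤ (6 * R' ^ 2 + 11) ^ 2 ∧
      Real.sqrt (6 * ∑ c, (F c ^ 4 + 3 * a ^ 2) + 6 * ∑ c, (G c ^ 4 + 3 * b ^ 2)) ≤ 6 * R' ^ 2 + 11 := by
  have hF4 : ∀ c, F c ^ 4 ≤ R' ^ 4 := fun c => by
    have h := pow_le_pow_left₀ (abs_nonneg _) (hF c) 4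
    rwa [pow_abs, abs_of_nonneg (by positivity : (0 : ℝ) ≤ F c ^ 4)] at h
  have hG4 : ∀ c, G c ^ 4 ≤ R' ^ 4 := fun c => by
    have h := pow_le_pow_left₀ (abs_nonneg _) (hG c) 4
    rwa [pow_abs, abs_of_nonneg (by positivity : (0 : ℝ) ≤ G c ^ 4)] at h
  have ha2 : a ^ 2 ≤ 1 := by nlinarith
  have hb2 : b ^ 2 ≤ 1 := by nlinarith
  have hs1 : ∑ c, (F c ^ 4 + 3 * a ^ 2) ≤ ∑ _c : Fin 3, (R' ^ 4 + 3) := Finset.sum_le_sum fun c _ => by linarith [hF4 c]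
  have hs2 : ∑ c, (G c ^ 4 + 3 * b ^ 2) ≤ ∑ _c : Fin 3, (R' ^ 4 + 3) := Finset.sum_le_sum fun c _ => by linarith [hG4 c]
  rw [Finset.sum_const, Finset.card_univ, Fintype.card_fin, nsmul_eq_mul] at hs1 hs2
  push_cast at hs1 hs2
  have hsq : 6 * ∑ c, (F c ^ 4 + 3 * a ^ 2) + 6 * ∑ c, (G c ^ 4 + 3 * b ^ 2) ≤ (6 * R' ^ 2 + 11) ^ 2 := by
    nlinarith [sq_nonneg R']
  refine ⟨hsq, ?_⟩
  exact (Real.sqrt_le_sqrt hsq).trans_eq (Real.sqrt_sq (by positivity))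

/-- `√((216Σ_c(F_c⁸+105a⁴) + 216Σ_c(G_c⁸+105b⁴))/2) ≤ 26R'⁴ + 261` when `|F_c|, |G_c| ≤ R'` and `a, b ∈ [0,1]`. -/
theorem sqrt_moment_four_le {F G : Fin 3 → ℝ} {R' a b : ℝ} (hR' : 0 ≤ R') (hF : ∀ c, |F c| ≤ R') (hG : ∀ c, |G c| ≤ R')
    (ha : 0 ≤ a) (ha1 : a ≤ 1) (hb : 0 ≤ b) (hb1 : b ≤ 1) :
    Real.sqrt ((216 * ∑ c, (F c ^ 8 + 105 * a ^ 4) + 216 * ∑ c, (G c ^ 8 + 105 * b ^ 4)) / 2) ≤ 26 * R' ^ 4 + 261 := by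
  have hF8 : ∀ c, F c ^ 8 ≤ R' ^ 8 := fun c => by
    have h := pow_le_pow_left₀ (abs_nonneg _) (hF c) 8
    rwa [pow_abs, abs_of_nonneg (by positivity : (0 : ℝ) ≤ F c ^ 8)] at h
  have hG8 : ∀ c, G c ^ 8 ≤ R' ^ 8 := fun c => by
    have h := pow_le_pow_left₀ (abs_nonneg _) (hG c) 8
    rwa [pow_abs, abs_of_nonneg (by positivity : (0 : ℝ) ≤ G c ^ 8)] at h
  have ha4 : a ^ 4 ≤ 1 := pow_le_one₀ ha ha1
  have hb4 : b ^ 4 ≤ 1 := pow_le_one₀ hb hb1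
  have hs1 : ∑ c, (F c ^ 8 + 105 * a ^ 4) ≤ ∑ _c : Fin 3, (R' ^ 8 + 105) := Finset.sum_le_sum fun c _ => by linarith [hF8 c]
  have hs2 : ∑ c, (G c ^ 8 + 105 * b ^ 4) ≤ ∑ _c : Fin 3, (R' ^ 8 + 105) := Finset.sum_le_sum fun c _ => by linarith [hG8 c]
  rw [Finset.sum_const, Finset.card_univ, Fintype.card_fin, nsmul_eq_mul] at hs1 hs2
  push_cast at hs1 hs2
  have hsq : (216 * ∑ c, (F c ^ 8 + 105 * a ^ 4) + 216 * ∑ c, (G c ^ 8 + 105 * b ^ 4)) / 2 ≤ (26 * R' ^ 4 + 261) ^ 2 := by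
    nlinarith [pow_nonneg hR' 4]
  exact (Real.sqrt_le_sqrt hsq).trans_eq (Real.sqrt_sq (by positivity))

/-! ## The core with datum at fixed `β` -/

set_option maxHeartbeats 400000 in
/-- **The one-scale expansion of the kernel covariance with datum, assembled at fixed `β` (deterministic core).**  See the module docstring:
every analytic input is a tree theorem (T3, T4, R3-datum, the goodTD sandwich, the abstract core with moments); the hypotheses left are REAL
inequalities between the bookkeeping parameters, discharged eventually in `β` by the stub file. -/
theorem abs_kernelCov_sub_gaussian_le_datum {β ε r m R R' P pY B ms : ℝ} {T : ℕ} (hβ : 1 ≤ β) (hH : 1 ≤ H) (hT : T ≤ H)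
    {W : LGConfig 4 (Matrix.specialUnitaryGroup (Fin 2) ℂ)} {ϑ : Fin 3 → Literature.MathematicalPhysics.QuantumLattice.ZdEdge 4 → ℝ}
    {s : Fin 3 → DirFree H → ℝ}
    (hW : ∀ e, e ∉ boxEdges 4 (2 * H + 1) → W e = gnomonicChart (fun c => ϑ c e))
    (hr : 0 ≤ r) (hϑ : ∀ e, e ∉ boxEdges 4 (2 * H + 1) → ∑ c, ϑ c e ^ 2 ≤ r ^ 2)
    (hforest : ∀ x : Site 4, (∀ k : Fin 4, 1 ≤ x k ∧ x k + 1 ≤ 2 * (H : ℤ)) → ∀ c, ϑ c (x, 0) = 0)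
    (hE : ∑ c, formM (fun e => e ∉ dirFreeEdges H) dirCorner (2 * H + 3) (ϑ c) (s c) ≤ B)
    (hR'B : Real.sqrt (2 * β * B) + 4 * (Real.sqrt (2 * β) * r) ≤ R')
    (hpY : (boxKernel β H W).real (coldGoodSet β ε H)ᶜ ≤ pY) (hpY1 : pY < 1)
    (hm : Real.sqrt 2 * ((12 * (H : ℝ) ^ 2 + 2 * H + 1) * (Real.sqrt (β ^ (2 * ε - 1)) + 8 * r)) ≤ m) (hm4 : m ≤ 1 / 4)
    (hR : 0 ≤ R) (hms0 : 0 ≤ ms)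
    (hms : r ^ 2 + 3 * ((12 * (H : ℝ) ^ 2 + 2 * H + 1) * ((R + R') + 4 * (Real.sqrt (2 * β) * r))) ^ 2 / (2 * β) ≤ ms ^ 2)
    (hms4 : ms ≤ 1 / 4) (hwin : 3 * (R + R') ^ 2 / (2 * β) + 362 * ms ^ 3 < β ^ (2 * ε - 1))
    (hP : 720 * (2 * (H : ℝ) + 1) ^ 4 * Real.exp (-R ^ 2 / 2) ≤ P) (hP1 : P < 1) :
    |β ^ 2 * ((∫ U, plaqCostAt (fundamentalRep (Fin 2)) (boxCentre H) 1 2 U *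
              plaqCostAt (fundamentalRep (Fin 2)) (boxCentre H + Pi.single 0 (T : ℤ)) 1 2 U ∂(boxKernel β H W)) -
          (∫ U, plaqCostAt (fundamentalRep (Fin 2)) (boxCentre H) 1 2 U ∂(boxKernel β H W)) *
            (∫ U, plaqCostAt (fundamentalRep (Fin 2)) (boxCentre H + Pi.single 0 (T : ℤ)) 1 2 U ∂(boxKernel β H W))) -
        3 / 2 * boxDirProjKernel H (boxCentre H, 1, 2) (boxCentre H + Pi.single 0 (T : ℤ), 1, 2) ^ 2 -
        2 * β * (∑ c,
            sCirc (glue (pin := fun e => e ∉ dirFreeEdges H) dirCorner (2 * H + 3) (ϑ c)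
                (mean (fun e => e ∉ dirFreeEdges H) dirCorner (2 * H + 3) (ϑ c))) (boxCentre H, 1, 2) *
              sCirc (glue (pin := fun e => e ∉ dirFreeEdges H) dirCorner (2 * H + 3) (ϑ c)
                (mean (fun e => e ∉ dirFreeEdges H) dirCorner (2 * H + 3) (ϑ c))) (boxCentre H + Pi.single 0 (T : ℤ), 1, 2)) *
          boxDirProjKernel H (boxCentre H, 1, 2) (boxCentre H + Pi.single 0 (T : ℤ), 1, 2)| ≤
      96 * β ^ 2 * pY +
        (3 * (β ^ (2 * ε)) ^ 2 * (Real.exp (2 * ((#(plaquettesTouching (boxEdges 4 (2 * H + 1))) : ℝ) * (362 * β * m ^ 3) +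
            2 * (Fintype.card (ColdFreeIdx H) : ℝ) * m ^ 2)) - 1) +
          6 * (β ^ (2 * ε)) ^ 2 * P + 2 * (362 * β * m ^ 3) * (β ^ (2 * ε) + (6 * R' ^ 2 + 11)) +
          Real.sqrt P * (2 * β ^ (2 * ε) * (6 * R' ^ 2 + 11) + (26 * R' ^ 4 + 261) + (6 * R' ^ 2 + 11) ^ 2)) := by
  have hβ0 : 0 < β := by linarith
  -- abbreviations
  set ρ := fundamentalRep (Fin 2) with hρ
  set μ := boxKernel β H W with hμ
  set G := coldGoodSet β ε H with hG
  set γ : Measure (TSpace H) := gauss3 H with hγ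
  set S := goodTD H β ε ϑ with hS
  set x₁ : Site 4 := boxCentre H with hx₁
  set x₂ : Site 4 := boxCentre H + Pi.single 0 (T : ℤ) with hx₂
  set Fp : Fin 3 → ℝ := fun c => sCirc (glue (pin := fun e => e ∉ dirFreeEdges H) dirCorner (2 * H + 3) (ϑ c)
      (mean (fun e => e ∉ dirFreeEdges H) dirCorner (2 * H + 3) (ϑ c))) (x₁, 1, 2) with hFp
  set Fq : Fin 3 → ℝ := fun c => sCirc (glue (pin := fun e => e ∉ dirFreeEdges H) dirCorner (2 * H + 3) (ϑ c)
      (mean (fun e => e ∉ dirFreeEdges H) dirCorner (2 * H + 3) (ϑ c))) (x₂, 1, 2) with hFq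
  set Fb : Fin 3 → ℝ := fun c => Real.sqrt (2 * β) * Fp c with hFb
  set Gb : Fin 3 → ℝ := fun c => Real.sqrt (2 * β) * Fq c with hGb
  set τ : ℝ := 362 * β * m ^ 3 with hτ
  set w : ℝ := (#(plaquettesTouching (boxEdges 4 (2 * H + 1))) : ℝ) * τ + 2 * (Fintype.card (ColdFreeIdx H) : ℝ) * m ^ 2 with hw
  set M : ℝ := β ^ (2 * ε) with hM
  have hm0 : 0 ≤ m := le_trans (by positivity) hm
  have hτ0 : 0 ≤ τ := by positivity
  have hM0 : 0 ≤ M := by positivity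
  have hR'0 : 0 ≤ R' := le_trans (by positivity) hR'B
  -- (a) the scaled background circulation is `≤ R'` on every plaquette
  have hF : ∀ (c : Fin 3) (p : ZdPlaquette 4), |sCirc (glue (pin := fun e => e ∉ dirFreeEdges H) dirCorner (2 * H + 3) (sdat β ϑ c)
      (mean (fun e => e ∉ dirFreeEdges H) dirCorner (2 * H + 3) (sdat β ϑ c))) (p.1, p.2.1.1, p.2.1.2)| ≤ R' :=
    fun c p => (abs_dirBackground_sdat_le hβ0.le hr s hE hϑ c p).trans hR'B
  -- (b) the Gaussian bad mass and `γ S ≠ 0`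
  have hpS : γ.real Sᶜ ≤ P := (gauss3_real_compl_goodTD_le hβ0 hH hr hR hR'0 hϑ hforest hF hms0 hms hms4 hwin).trans hP
  have hS0 : γ S ≠ 0 := by
    intro h0
    have h1 : γ.real S = 0 := by rw [measureReal_def, h0, ENNReal.toReal_zero]
    have h2 : γ.real S + γ.real Sᶜ = 1 := by rw [measureReal_add_measureReal_compl (measurableSet_goodTD β ε ϑ), probReal_univ]
    linarith
  -- (c) the kernel charges the YM good event
  haveI := isProbabilityMeasure_boxKernel β H W
  have hG0 : μ G ≠ 0 := by
    intro h0
    have h1 : μ.real G = 0 := by rw [measureReal_def, h0, ENNReal.toReal_zero]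
    have h2 : μ.real G + μ.real Gᶜ = 1 := by rw [measureReal_add_measureReal_compl (measurableSet_coldGoodSet β ε H), probReal_univ]
    linarith
  -- (d) the T3 window from the T4 link bound (`√2 ≥ 1`, `m ≤ 1/4`)
  have hwin3 : (12 * (H : ℝ) ^ 2 + 2 * H + 1) * (Real.sqrt (β ^ (2 * ε - 1)) + 8 * r) ≤ 1 := by
    have hs2 : (1 : ℝ) ≤ Real.sqrt 2 := by
      rw [show (1 : ℝ) = Real.sqrt 1 by rw [Real.sqrt_one]]; exact Real.sqrt_le_sqrt (by norm_num)
    have h0 : 0 ≤ (12 * (H : ℝ) ^ 2 + 2 * H + 1) * (Real.sqrt (β ^ (2 * ε - 1)) + 8 * r) := by positivity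
    nlinarith
  -- (e) the three representation identities (T3)
  have hrepF : ∫ U, β * plaqCostAt ρ x₁ 1 2 U ∂(μ[|G]) =
      ∫ t, β * plaqCostAt ρ x₁ 1 2 (cfgTD H β ϑ t) ∂((γ[|S]).tilted (S.indicator (tiltWD H β ϑ))) :=
    integral_cond_boxKernel_eq_integral_tilted_datum hβ0 hH hr hwin3 hW hϑ hG0 hS0 ((measurable_plaqCostAt _ _ _).const_mul β)
      (isZdGaugeInvariant_const_mul_plaqCostAt β x₁ 1 2) (fun U => mul_nonneg hβ0.le (plaqCostAt_nonneg _ _ _ _))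
  have hrepG : ∫ U, β * plaqCostAt ρ x₂ 1 2 U ∂(μ[|G]) =
      ∫ t, β * plaqCostAt ρ x₂ 1 2 (cfgTD H β ϑ t) ∂((γ[|S]).tilted (S.indicator (tiltWD H β ϑ))) :=
    integral_cond_boxKernel_eq_integral_tilted_datum hβ0 hH hr hwin3 hW hϑ hG0 hS0 ((measurable_plaqCostAt _ _ _).const_mul β)
      (isZdGaugeInvariant_const_mul_plaqCostAt β x₂ 1 2) (fun U => mul_nonneg hβ0.le (plaqCostAt_nonneg _ _ _ _))
  have hrepFG : ∫ U, β * plaqCostAt ρ x₁ 1 2 U * (β * plaqCostAt ρ x₂ 1 2 U) ∂(μ[|G]) =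
      ∫ t, β * plaqCostAt ρ x₁ 1 2 (cfgTD H β ϑ t) * (β * plaqCostAt ρ x₂ 1 2 (cfgTD H β ϑ t))
        ∂((γ[|S]).tilted (S.indicator (tiltWD H β ϑ))) :=
    integral_cond_boxKernel_eq_integral_tilted_datum hβ0 hH hr hwin3 hW hϑ hG0 hS0
      (((measurable_plaqCostAt _ _ _).const_mul β).mul ((measurable_plaqCostAt _ _ _).const_mul β))
      (isZdGaugeInvariant_const_mul_plaqCostAt_mul β x₁ x₂ 1 2 1 2)
      (fun U => mul_nonneg (mul_nonneg hβ0.le (plaqCostAt_nonneg _ _ _ _)) (mul_nonneg hβ0.le (plaqCostAt_nonneg _ _ _ _)))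
  -- (f) the tilt bound (T4), the on-`S` bounds and the surrogates (R3-datum + units)
  have hPc := centre_mem_plaquettesTouching hH hT
  have hWb : ∀ t, |S.indicator (tiltWD H β ϑ) t| ≤ w := by
    intro t
    by_cases ht : t ∈ S
    · rw [Set.indicator_of_mem ht]
      exact abs_tiltWD_le_of_mem_goodTD hβ0 hH hr hϑ hforest hm hm4 ht
    · rw [Set.indicator_of_notMem ht, abs_zero, hw]; positivity
  have hFS : ∀ t ∈ S, 0 ≤ β * plaqCostAt ρ x₁ 1 2 (cfgTD H β ϑ t) ∧ β * plaqCostAt ρ x₁ 1 2 (cfgTD H β ϑ t) ≤ M := fun t ht => by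
    have h := beta_mul_plaqCostAt_mem_Icc_of_mem_goodTD hβ0 ht hPc.1
    exact h
  have hGS : ∀ t ∈ S, 0 ≤ β * plaqCostAt ρ x₂ 1 2 (cfgTD H β ϑ t) ∧ β * plaqCostAt ρ x₂ 1 2 (cfgTD H β ϑ t) ≤ M := fun t ht => by
    have h := beta_mul_plaqCostAt_mem_Icc_of_mem_goodTD hβ0 ht hPc.2
    exact h
  have hSurF : ∀ t ∈ S, |β * plaqCostAt ρ x₁ 1 2 (cfgTD H β ϑ t) - 1 / 2 * ∑ c, (Fb c + dirCirc H (x₁, 1, 2) (t c)) ^ 2| ≤ τ := by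
    intro t ht
    have h := abs_beta_mul_plaqCostAt_sub_qObsD_le_of_mem_goodTD hβ0 hH hr hϑ hforest hm hm4 ht hPc.1
    rw [qObsD_eq_half_sum_sq] at h
    exact h
  have hSurG : ∀ t ∈ S, |β * plaqCostAt ρ x₂ 1 2 (cfgTD H β ϑ t) - 1 / 2 * ∑ c, (Gb c + dirCirc H (x₂, 1, 2) (t c)) ^ 2| ≤ τ := by
    intro t ht
    have h := abs_beta_mul_plaqCostAt_sub_qObsD_le_of_mem_goodTD hβ0 hH hr hϑ hforest hm hm4 ht hPc.2
    rw [qObsD_eq_half_sum_sq] at h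
    exact h
  -- (g) the abstract core with the Gaussian moments discharged
  have hcore := abs_kernelCov_sub_gaussian_le_moments (H := H) (β := β) W x₁ x₂ 1 2 1 2 (measurableSet_coldGoodSet β ε H) hG0 hpY hM0
    (cfgTD H β ϑ) (measurable_cfgTD β ϑ) (measurableSet_goodTD β ε ϑ) hS0 hpS (measurable_tiltWD β ϑ) hWb hrepF hrepG hrepFG
    Fb Gb (x₁, 1, 2) (x₂, 1, 2) hτ0 hFS hGS hSurF hSurG
  -- (h) the moment constants: `|F_c|, |G_c| ≤ R'`, `0 ≤ C_D(p,p) ≤ 1`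
  have hFbR : ∀ c, |Fb c| ≤ R' := fun c => by
    have h := hF c ((x₁, ⟨((1 : Fin 4), (2 : Fin 4)), by decide⟩) : ZdPlaquette 4)
    rw [dirBackground_sdat_eq] at h
    exact h
  have hGbR : ∀ c, |Gb c| ≤ R' := fun c => by
    have h := hF c ((x₂, ⟨((1 : Fin 4), (2 : Fin 4)), by decide⟩) : ZdPlaquette 4)
    rw [dirBackground_sdat_eq] at h
    exact h
  obtain ⟨hv1, hv2⟩ := integral_dirCirc_sq_le_one_centre hH hT
  have hC1 : boxDirProjKernel H (x₁, 1, 2) (x₁, 1, 2) ≤ 1 := by rw [integral_dirCirc_sq] at hv1; exact hv1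
  have hC2 : boxDirProjKernel H (x₂, 1, 2) (x₂, 1, 2) ≤ 1 := by rw [integral_dirCirc_sq] at hv2; exact hv2
  have hC1' : 0 ≤ boxDirProjKernel H (x₁, 1, 2) (x₁, 1, 2) := boxDirProjKernel_self_nonneg _
  have hC2' : 0 ≤ boxDirProjKernel H (x₂, 1, 2) (x₂, 1, 2) := boxDirProjKernel_self_nonneg _
  obtain ⟨hKsq, hK⟩ := sqrt_moment_two_le hFbR hGbR hC1' hC1 hC2' hC2
  have hK' := sqrt_moment_four_le hR'0 hFbR hGbR hC1' hC1 hC2' hC2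
  -- the cross term in the interface's units
  have hcross : ∑ c, Fb c * Gb c = 2 * β * ∑ c, Fp c * Fq c := by
    simp only [hFb, hGb]
    exact sum_sdat_shift_mul_eq hβ0.le _ _
  rw [hcross] at hcore
  have h96 : 6 * (4 * |β|) * (4 * |β|) * pY = 96 * β ^ 2 * pY := by rw [abs_of_pos hβ0]; ring
  rw [h96] at hcore
  have hsqP : 0 ≤ Real.sqrt P := Real.sqrt_nonneg _
  have h1 : 2 * τ * (M + Real.sqrt (6 * ∑ c, (Fb c ^ 4 + 3 * boxDirProjKernel H (x₁, 1, 2) (x₁, 1, 2) ^ 2) +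
      6 * ∑ c, (Gb c ^ 4 + 3 * boxDirProjKernel H (x₂, 1, 2) (x₂, 1, 2) ^ 2))) ≤ 2 * τ * (M + (6 * R' ^ 2 + 11)) :=
    mul_le_mul_of_nonneg_left (add_le_add le_rfl hK) (mul_nonneg (by norm_num) hτ0)
  have h2 : Real.sqrt P * (2 * M * Real.sqrt (6 * ∑ c, (Fb c ^ 4 + 3 * boxDirProjKernel H (x₁, 1, 2) (x₁, 1, 2) ^ 2) +
        6 * ∑ c, (Gb c ^ 4 + 3 * boxDirProjKernel H (x₂, 1, 2) (x₂, 1, 2) ^ 2)) +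
      Real.sqrt ((216 * ∑ c, (Fb c ^ 8 + 105 * boxDirProjKernel H (x₁, 1, 2) (x₁, 1, 2) ^ 4) +
        216 * ∑ c, (Gb c ^ 8 + 105 * boxDirProjKernel H (x₂, 1, 2) (x₂, 1, 2) ^ 4)) / 2) +
      (6 * ∑ c, (Fb c ^ 4 + 3 * boxDirProjKernel H (x₁, 1, 2) (x₁, 1, 2) ^ 2) +
        6 * ∑ c, (Gb c ^ 4 + 3 * boxDirProjKernel H (x₂, 1, 2) (x₂, 1, 2) ^ 2))) ≤
      Real.sqrt P * (2 * M * (6 * R' ^ 2 + 11) + (26 * R' ^ 4 + 261) + (6 * R' ^ 2 + 11) ^ 2) :=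
    mul_le_mul_of_nonneg_left (add_le_add (add_le_add (mul_le_mul_of_nonneg_left hK (mul_nonneg (by norm_num) hM0)) hK') hKsq) hsqP
  have e : β ^ 2 * ((∫ U, plaqCostAt ρ x₁ 1 2 U * plaqCostAt ρ x₂ 1 2 U ∂μ) -
          (∫ U, plaqCostAt ρ x₁ 1 2 U ∂μ) * (∫ U, plaqCostAt ρ x₂ 1 2 U ∂μ)) -
        3 / 2 * boxDirProjKernel H (x₁, 1, 2) (x₂, 1, 2) ^ 2 -
        2 * β * (∑ c, Fp c * Fq c) * boxDirProjKernel H (x₁, 1, 2) (x₂, 1, 2) =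
      β ^ 2 * ((∫ U, plaqCostAt ρ x₁ 1 2 U * plaqCostAt ρ x₂ 1 2 U ∂μ) -
          (∫ U, plaqCostAt ρ x₁ 1 2 U ∂μ) * (∫ U, plaqCostAt ρ x₂ 1 2 U ∂μ)) -
        (3 / 2 * boxDirProjKernel H (x₁, 1, 2) (x₂, 1, 2) ^ 2 +
          (2 * β * ∑ c, Fp c * Fq c) * boxDirProjKernel H (x₁, 1, 2) (x₂, 1, 2)) := by ring
  rw [e]
  refine hcore.trans ?_
  linarith

end Summit.QuantumFields.YangMills.Theorems.WeakCouplingRates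

end
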